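import Literature.NumberTheory.EllipticCurves.UnramifiedCoboundaryInputs
import Literature.NumberTheory.EllipticCurves.UnramifiedFormalGroupH1Proofs
import Mathlib.GroupTheory.GroupAction.Quotient
import HarnessLib

/-!
# Almost-étale successive approximation in the kernel of reduction: `H¹(G, E₁) = 0` in cocycle
# form, granted ONE integral element with trace of valuation close to `1` (Coates–Greenberg 1996
# Thm. 3.1 / Bondarko 2007 Thm. 9.2 — the mechanism, abstractly)

HONEST FRAMING (BSD rank-`≤ 1` residual cell `b2b-bsdres`, home
`run/shared/lean/b2b/bsd-rank1-residual/`, team n1011, seat n1011-p05 GEN 9, row T-CG-DR, skeleton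
`cells/n1011/skel/T-CG-DR.md`): the cell deletes the COMBINATION-SHAPED residual classes of the
rank-`≤ 1` BSD formula from PUBLISHED theorems only and TYPES the construction-shaped ones;
research route, no claim beyond the stated classes, census output = EVIDENCE, nothing booked, no
mark moves. TOOL file (theorems only, no definition, no named fact): the abstract engine by which
the Coates–Greenberg record `CoatesGreenberg1996.H1_goodModelKernel_trivial` (A254, `hCG` of the
Route-2 e346 ENDs, of S2/A239/A111 and of (I2)) is DERIVED from the trace form of "deeply ramified"
in the sibling `GoodModelKernelH1OfDeeplyRamified`.

## The theorem (twin of the tree's Milne-I.3.8 engine `FormalGroupChart.exists_map_sub_eq_of_sum_eq_zero`)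

Data: a valued field `(L, w)`, a `w`-integral Weierstrass equation `V/L` (kernel of reduction
`E₁ = FormalGroupChart.kernel w V`, parameter `z = -x/y`); a group `G` acting on `L` by isometric
ring automorphisms `σ_g` (`σ_{gh} = σ_g σ_h`) and on `V(L)` by additive maps `T_g` with `T_g E₁ ⊆ E₁`,
`z(T_g P) = σ_g (z P)`, `T_{gh} = T_g T_h` (in the application `T_g = Φ_C ∘ g ∘ Φ_C⁻¹`); a subgroup
`U ≤ G` of finite index; a subfield `S ≤ L` stable under the `σ_g` and FIXED by the `σ_u` (the
finite layer) and a subgroup `Rat ≤ V(L)` stable under the `T_g`, fixed by the `T_u`, whose points of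
`E₁` have parameters in `S`; Hensel lifts in `E₁ ∩ Rat` of every `z ∈ S`, `|z| < 1`; completeness of
`S` for geometric moduli; an integral `x ∈ S` whose trace `y := Σ_{q ∈ G/U} σ_{q.out} x` has
`η = |y| > 0`. Claim (`exists_forall_eq_sub_of_cocycle_of_trace`): **every crossed homomorphism
`c : G → E₁ ∩ Rat` vanishing on `U` with `|z(c g)| ≤ η² θ`, `θ < 1`, is `c g = T_g P − P` for some
`P ∈ E₁ ∩ Rat`.**

## The argument

STEP (`exists_step_of_trace`): if `|z(e g)| ≤ η² s` (`s < 1`), put `f g = z(e g)`,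
`b = Σ_q f(q̃) σ_{q̃} x ∈ S`, `B = b / y` (`|B| ≤ η s < 1`), `Q ∈ E₁ ∩ Rat` with `z(Q) = B`. The
cocycle identity and the chart congruence `|z(P₁ + P₂) − z P₁ − z P₂| ≤ max²` give
`σ_g f(q̃) = f(g q̃) − f g − δ_q`, `|δ_q| ≤ (η² s)²`; `f` and `k ↦ σ_k x` are right-`U`-invariant,
so re-indexing `q ↦ g • q` on `G/U` gives `σ_g b = b − f(g)·y − err`, `|err| ≤ (η² s)²`, whence
`f g + σ_g B − B = −err/y` has valuation `≤ η³ s² ≤ η² s²`, and `|z(e g + T_g Q − Q)| ≤ η² s²`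
for the cocycle `e + ∂Q` (again vanishing on `U`). LIMIT: from `c` (`s = θ`) the bounds are
`η² θ^{2^r} ≤ η² θ^{r+1}`, the corrections `|z Q_r| ≤ η θ^{r+1}`, so the partial sums `P_r` have
Cauchy parameters converging in `S` to the parameter of some `P ∈ E₁ ∩ Rat`, and `c + ∂P`, with
parameters `≤ θ^{r+1}` for every `r`, vanishes. (The tree's unramified engine is the case `G/U`
cyclic with the graded additive Hilbert 90 in place of the trace element.)

References: J. Coates, R. Greenberg, Invent. Math. 124 (1996) §3 Thm. 3.1 (proof)
[CoatesGreenberg1996]; M. V. Bondarko, LMS LN 338 (2007) §9.2 Thm. 9.2 (held p0081: "(9.2)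
`lim d(Ek_i/k_i)/e(k_i/k) = 0` ⇒ `H¹(G, F(L)) = {0}`") [Bondarko2007FormalGroupsSurvey]; J. Tate,
*p-divisible groups* (1967) §3; J. H. Silverman, *AEC* IV.1, VII.2.1–2.2 [SilvermanAEC2009]; J.-P.
Serre, *Local Fields* V §2 / XIII §1 [SerreLocalFields1979]; tree: `UnramifiedFormalGroupH1Proofs`.
-/

noncomputable section

open scoped Classical NNReal

open WeierstrassCurve

universe u v

namespace Summit.BirchSwinnertonDyer.Rank1Residual.Additive.GoodModelLine.AlmostEtale

open Literature.NumberTheory.EllipticCurves Literature.NumberTheory.EllipticCurves.FormalGroupChart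

variable {L : Type u} [Field L] {w : Valuation L ℝ≥0} {V : WeierstrassCurve L}
  [hV : V.IsIntegral w.integer]
variable {G : Type v} [Group G] {U : Subgroup G}

/-! ## §1 Cosets: representatives of `g • q` and `g * q.out` differ by an element of `U` -/
/-- The representative of `g • q` is `g * q.out * u` for some `u ∈ U` (`q ∈ G/U`). [folklore] -/
theorem exists_out_smul_eq_mul (g : G) (q : G ⧸ U) :
    ∃ u ∈ U, (g • q).out = g * q.out * u := by
  have h1 : g • q = (QuotientGroup.mk (g * q.out) : G ⧸ U) := by
    conv_lhs => rw [← QuotientGroup.out_eq' q]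
    rfl
  obtain ⟨u, hu⟩ := QuotientGroup.mk_out_eq_mul U (g * q.out)
  exact ⟨u, u.2, by rw [h1, hu]⟩

/-- A right-`U`-invariant function agrees at `(g • q).out` and `g * q.out`. [folklore] -/
theorem apply_out_smul_eq {M : Sort*} (F : G → M) (hF : ∀ k, ∀ u ∈ U, F (k * u) = F k)
    (g : G) (q : G ⧸ U) : F (g • q).out = F (g * q.out) := by
  obtain ⟨u, hu, h⟩ := exists_out_smul_eq_mul g q
  rw [h, hF _ u hu]

/-! ## §2 Crossed homomorphisms for an action `T` on points -/
section Cocycle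

variable {T : G → V.toAffine.Point →+ V.toAffine.Point}

/-- Right `U`-invariance of a crossed homomorphism vanishing on `U`. [folklore] -/
theorem cocycle_apply_mul_of_mem {e : G → V.toAffine.Point}
    (he : ∀ g h, e (g * h) = e g + T g (e h)) (heU : ∀ u ∈ U, e u = 0) (k : G) {u : G}
    (hu : u ∈ U) : e (k * u) = e k := by
  rw [he, heU u hu, map_zero, add_zero]

/-- The coboundary `g ↦ T_g Q − Q` is a crossed homomorphism (`T_{gh} = T_g T_h`). [folklore] -/
theorem coboundary_mul (hT : ∀ g h P, T (g * h) P = T g (T h P)) (Q : V.toAffine.Point)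
    (g h : G) : T (g * h) Q - Q = (T g Q - Q) + T g (T h Q - Q) := by
  rw [hT, map_sub]; abel

/-- Twisting a crossed homomorphism by a coboundary gives a crossed homomorphism. [folklore] -/
theorem cocycle_add_coboundary {e : G → V.toAffine.Point}
    (he : ∀ g h, e (g * h) = e g + T g (e h)) (hT : ∀ g h P, T (g * h) P = T g (T h P))
    (Q : V.toAffine.Point) (g h : G) :
    e (g * h) + (T (g * h) Q - Q) = (e g + (T g Q - Q)) + T g (e h + (T h Q - Q)) := by
  rw [he, coboundary_mul hT, map_add]; abel

end Cocycle

/-! ## §3 One step of the almost-étale successive approximation -/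
section Step

variable [Fintype (G ⧸ U)] {σ : G → (L ≃+* L)} {T : G → V.toAffine.Point →+ V.toAffine.Point}
  {S : Subfield L} {Rat : AddSubgroup V.toAffine.Point} {x : L}

/-- The trace `y = Σ_{q ∈ G/U} σ_{q.out} x` of a `U`-fixed `x` is `G`-invariant. [folklore] -/
theorem map_trace_eq (hσmul : ∀ g h z, σ (g * h) z = σ g (σ h z))
    (hσU : ∀ u ∈ U, ∀ s ∈ S, σ u s = s) (hxS : x ∈ S) (g : G) :
    σ g (∑ q : G ⧸ U, σ q.out x) = ∑ q : G ⧸ U, σ q.out x := by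
  rw [map_sum]
  have hinv : ∀ k, ∀ u ∈ U, σ (k * u) x = σ k x := fun k u hu ↦ by
    rw [hσmul, hσU u hu x hxS]
  have key : ∀ q : G ⧸ U, σ g (σ q.out x) = σ (g • q).out x := fun q ↦ by
    rw [apply_out_smul_eq (fun k ↦ σ k x) hinv g q, hσmul]
  simp_rw [key]
  exact Equiv.sum_comp (MulAction.toPerm g) (fun q : G ⧸ U ↦ σ q.out x)

/-- **One step.** Hypotheses as in the module docstring; given a crossed homomorphism
`e : G → E₁ ∩ Rat` vanishing on `U` with `|z(e g)| ≤ η² s` (`η = |y|`, `s < 1`), there is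
`Q ∈ E₁ ∩ Rat` with `|z Q| ≤ η s` such that `e + ∂Q` (again a crossed homomorphism
`G → E₁ ∩ Rat` vanishing on `U`) has `|z| ≤ η² s²`. [folklore] -/
theorem exists_step_of_trace (hσmul : ∀ g h z, σ (g * h) z = σ g (σ h z))
    (hσw : ∀ g z, w (σ g z) = w z)
    (hTker : ∀ g P, P ∈ kernel w V → T g P ∈ kernel w V)
    (hTz : ∀ g P, P ∈ kernel w V → (T g P).zCoord = σ g P.zCoord)
    (hSσ : ∀ g, ∀ s ∈ S, σ g s ∈ S) (hσU : ∀ u ∈ U, ∀ s ∈ S, σ u s = s)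
    (hRatU : ∀ u ∈ U, ∀ P ∈ Rat, T u P = P)
    (hRatz : ∀ P ∈ Rat, P ∈ kernel w V → P.zCoord ∈ S)
    (hlift : ∀ z ∈ S, w z < 1 → ∃ P ∈ kernel w V, P ∈ Rat ∧ P.zCoord = z)
    (hx1 : w x ≤ 1) (hxS : x ∈ S) (hy : 0 < w (∑ q : G ⧸ U, σ q.out x))
    {s : ℝ≥0} (hs : s < 1)
    {e : G → V.toAffine.Point} (he : ∀ g h, e (g * h) = e g + T g (e h))
    (heK : ∀ g, e g ∈ kernel w V) (heR : ∀ g, e g ∈ Rat) (heU : ∀ u ∈ U, e u = 0)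
    (hez : ∀ g, w (e g).zCoord ≤ w (∑ q : G ⧸ U, σ q.out x) ^ 2 * s) :
    ∃ Q : V.toAffine.Point, Q ∈ kernel w V ∧ Q ∈ Rat ∧
      w Q.zCoord ≤ w (∑ q : G ⧸ U, σ q.out x) * s ∧
      (∀ u ∈ U, e u + (T u Q - Q) = 0) ∧
      ∀ g, w (e g + (T g Q - Q)).zCoord ≤ w (∑ q : G ⧸ U, σ q.out x) ^ 2 * s ^ 2 := by
  -- notation
  set y : L := ∑ q : G ⧸ U, σ q.out x with hydef
  set η : ℝ≥0 := w y with hηdef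
  have hη1 : η ≤ 1 := by
    refine Valuation.map_sum_le w fun q _ ↦ ?_
    rw [hσw]; exact hx1
  have hy0 : y ≠ 0 := fun h ↦ by rw [hηdef, h, map_zero] at hy; exact lt_irrefl _ hy
  have hyS : y ∈ S := Subfield.sum_mem S fun q _ ↦ hSσ _ x hxS
  have hσy : ∀ g, σ g y = y := map_trace_eq hσmul hσU hxS
  have ht1 : η ^ 2 * s ≤ η * s := by
    rw [sq, mul_assoc]; exact mul_le_of_le_one_left zero_le hη1
  have hηs1 : η * s < 1 := by
    calc η * s ≤ 1 * s := by gcongr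
      _ = s := one_mul s
      _ < 1 := hs
  -- right `U`-invariance of `e` and of `k ↦ σ_k x`
  have heinv : ∀ k, ∀ u ∈ U, e (k * u) = e k := fun k u hu ↦ cocycle_apply_mul_of_mem he heU k hu
  have hσinv : ∀ k, ∀ u ∈ U, σ (k * u) x = σ k x := fun k u hu ↦ by
    rw [hσmul, hσU u hu x hxS]
  -- the parameters `f g = z(e g)` and the element `b`
  set f : G → L := fun g ↦ (e g).zCoord with hfdef
  have hfS : ∀ g, f g ∈ S := fun g ↦ hRatz _ (heR g) (heK g)
  have hfinv : ∀ k, ∀ u ∈ U, f (k * u) = f k := fun k u hu ↦ by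
    simp only [hfdef, heinv k u hu]
  set b : L := ∑ q : G ⧸ U, f q.out * σ q.out x with hbdef
  have hbS : b ∈ S := Subfield.sum_mem S fun q _ ↦ S.mul_mem (hfS _) (hSσ _ x hxS)
  have hbw : w b ≤ η ^ 2 * s := by
    refine Valuation.map_sum_le w fun q _ ↦ ?_
    rw [map_mul, hσw]
    calc w (f q.out) * w x ≤ η ^ 2 * s * 1 := by gcongr; exact hez _
      _ = η ^ 2 * s := mul_one _
  set B : L := b * y⁻¹ with hBdef
  have hBS : B ∈ S := S.mul_mem hbS (S.inv_mem hyS)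
  have hBw : w B ≤ η * s := by
    rw [hBdef, map_mul, map_inv₀, ← hηdef]
    have hη0 : η ≠ 0 := hy.ne'
    calc w b * η⁻¹ ≤ η ^ 2 * s * η⁻¹ := by gcongr
      _ = η * s := by field_simp
  have hBlt : w B < 1 := hBw.trans_lt hηs1
  -- the Hensel lift
  obtain ⟨Q, hQK, hQR, hQz⟩ := hlift B hBS hBlt
  have hTQK : ∀ g, T g Q ∈ kernel w V := fun g ↦ hTker g Q hQK
  have hTQz : ∀ g, (T g Q).zCoord = σ g B := fun g ↦ by rw [hTz g Q hQK, hQz]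
  refine ⟨Q, hQK, hQR, by rw [hQz]; exact hBw, fun u hu ↦ ?_, fun g ↦ ?_⟩
  · rw [heU u hu, hRatU u hu Q hQR, sub_self, add_zero]
  -- the estimate for `e g + (T g Q - Q)`
  have hAK : e g + T g Q ∈ kernel w V := (kernel w V).add_mem (heK g) (hTQK g)
  rw [← add_sub_assoc, ← val_zCoord_sub hAK hQK, hQz]
  -- (a) the chart congruence for `A = e g + T g Q`
  have hδ₁ : w ((e g + T g Q).zCoord - f g - σ g B) ≤ (η * s) ^ 2 := by
    rw [← hTQz g]
    refine (val_zCoord_add_sub_le (heK g) (hTQK g)).trans ?_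
    gcongr
    refine max_le ((hez g).trans ht1) ?_
    rw [hTQz, hσw]; exact hBw
  -- (b) the cocycle identity on parameters: `σ_g f(q̃) = f(g q̃) - f g - δ₂ q`
  have hδ₂ : ∀ q : G ⧸ U,
      w (f (g * q.out) - f g - σ g (f q.out)) ≤ (η ^ 2 * s) ^ 2 := by
    intro q
    have hPK : T g (e q.out) ∈ kernel w V := hTker g _ (heK _)
    have e1 : f (g * q.out) - f g - σ g (f q.out) =
        (e g + T g (e q.out)).zCoord - (e g).zCoord - (T g (e q.out)).zCoord := by
      simp only [hfdef]; rw [he g q.out, hTz g _ (heK _)]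
    rw [e1]
    refine (val_zCoord_add_sub_le (heK g) hPK).trans ?_
    gcongr
    refine max_le (hez g) ?_
    rw [hTz g _ (heK _), hσw]; exact hez _
  -- (c) `σ_g b = b - f g * y - err`
  set err : L := ∑ q : G ⧸ U, (f (g * q.out) - f g - σ g (f q.out)) * σ (g • q).out x
    with herrdef
  have herrw : w err ≤ (η ^ 2 * s) ^ 2 := by
    refine Valuation.map_sum_le w fun q _ ↦ ?_
    rw [map_mul, hσw]
    calc w (f (g * q.out) - f g - σ g (f q.out)) * w x ≤ (η ^ 2 * s) ^ 2 * 1 := by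
          gcongr; exact hδ₂ q
      _ = (η ^ 2 * s) ^ 2 := mul_one _
  have hσb : σ g b = b - f g * y - err := by
    have h1 : σ g b = ∑ q : G ⧸ U, σ g (f q.out) * σ (g • q).out x := by
      rw [hbdef, map_sum]
      refine Finset.sum_congr rfl fun q _ ↦ ?_
      rw [map_mul, apply_out_smul_eq (fun k ↦ σ k x) hσinv g q, hσmul]
    have h2 : ∀ q : G ⧸ U, σ g (f q.out) * σ (g • q).out x =
        f (g • q).out * σ (g • q).out x - f g * σ (g • q).out x -
          (f (g * q.out) - f g - σ g (f q.out)) * σ (g • q).out x := by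
      intro q
      rw [apply_out_smul_eq f hfinv g q]; ring
    rw [h1, Finset.sum_congr rfl fun q _ ↦ h2 q, Finset.sum_sub_distrib, Finset.sum_sub_distrib,
      ← herrdef, ← Finset.mul_sum]
    have h3 : ∑ q : G ⧸ U, f (g • q).out * σ (g • q).out x = b :=
      Equiv.sum_comp (MulAction.toPerm g) (fun q : G ⧸ U ↦ f q.out * σ q.out x)
    have h4 : ∑ q : G ⧸ U, σ (g • q).out x = y :=
      Equiv.sum_comp (MulAction.toPerm g) (fun q : G ⧸ U ↦ σ q.out x)
    rw [h3, h4]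
  -- (d) `f g + σ_g B - B = -err / y`
  have hkey : f g + σ g B - B = -(err * y⁻¹) := by
    rw [hBdef, map_mul, map_inv₀, hσy g, hσb]
    field_simp
    ring
  have hkeyw : w (f g + σ g B - B) ≤ η ^ 2 * s ^ 2 := by
    rw [hkey, Valuation.map_neg, map_mul, map_inv₀, ← hηdef]
    have hη0 : η ≠ 0 := hy.ne'
    calc w err * η⁻¹ ≤ (η ^ 2 * s) ^ 2 * η⁻¹ := by gcongr
      _ = η ^ 2 * s ^ 2 * η := by field_simp
      _ ≤ η ^ 2 * s ^ 2 * 1 := by gcongr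
      _ = η ^ 2 * s ^ 2 := mul_one _
  -- (e) assemble
  have esplit : (e g + T g Q).zCoord - B =
      ((e g + T g Q).zCoord - f g - σ g B) + (f g + σ g B - B) := by ring
  rw [esplit]
  exact (Valuation.map_add w _ _).trans (max_le (hδ₁.trans (le_of_eq (mul_pow η s 2))) hkeyw)

/-! ## §4 The limit: every small crossed homomorphism is principal -/
/-- **Almost-étale successive approximation** (the mechanism of Coates–Greenberg 1996 Thm. 3.1 /
Bondarko 2007 Thm. 9.2, abstractly; twin of the tree's unramified engine
`FormalGroupChart.exists_map_sub_eq_of_sum_eq_zero`). Data and hypotheses as in the module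
docstring: isometric ring automorphisms `σ_g` of `(L, w)`, an action `T_g` on the points of a
`w`-integral `V/L` preserving `E₁` with `z(T_g P) = σ_g z(P)` and `T_{gh} = T_g T_h`;
a finite-index `U ≤ G`; a subfield `S` stable under the `σ_g` and fixed by the `σ_u`; a subgroup
`Rat` of points stable under the `T_g`, fixed by the `T_u`, whose `E₁`-points have parameters in
`S`; Hensel lifts in `E₁ ∩ Rat` of every `z ∈ S` with `|z| < 1`; completeness of `S` for sequences
with geometric modulus; an integral `x ∈ S` whose trace `y = Σ_{q ∈ G/U} σ_{q.out} x` has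
`|y| > 0`. Then **every crossed homomorphism `c : G → E₁ ∩ Rat` (`c (gh) = c g + T_g (c h)`)
vanishing on `U` with `|z(c g)| ≤ |y|² θ` for some `θ < 1` is principal**:
`c g = T_g P − P` for some `P ∈ E₁ ∩ Rat`.
[cite: CoatesGreenberg1996, §3 Thm. 3.1 (mechanism of proof)]
[cite: Bondarko2007FormalGroupsSurvey, §9.2 Thm. 9.2 (held p0081)] -/
theorem exists_forall_eq_sub_of_cocycle_of_trace (hσmul : ∀ g h z, σ (g * h) z = σ g (σ h z))
    (hσw : ∀ g z, w (σ g z) = w z) (hT : ∀ g h P, T (g * h) P = T g (T h P))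
    (hTker : ∀ g P, P ∈ kernel w V → T g P ∈ kernel w V)
    (hTz : ∀ g P, P ∈ kernel w V → (T g P).zCoord = σ g P.zCoord)
    (hSσ : ∀ g, ∀ s ∈ S, σ g s ∈ S) (hσU : ∀ u ∈ U, ∀ s ∈ S, σ u s = s)
    (hRatT : ∀ g, ∀ P ∈ Rat, T g P ∈ Rat) (hRatU : ∀ u ∈ U, ∀ P ∈ Rat, T u P = P)
    (hRatz : ∀ P ∈ Rat, P ∈ kernel w V → P.zCoord ∈ S)
    (hlift : ∀ z ∈ S, w z < 1 → ∃ P ∈ kernel w V, P ∈ Rat ∧ P.zCoord = z)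
    (hcomplete : ∀ θ : ℝ≥0, θ < 1 → ∀ a : ℕ → L, (∀ r, a r ∈ S) →
      (∀ r, w (a (r + 1) - a r) ≤ θ ^ (r + 1)) → ∃ z ∈ S, ∀ r, w (z - a r) ≤ θ ^ (r + 1))
    (hx1 : w x ≤ 1) (hxS : x ∈ S) (hy : 0 < w (∑ q : G ⧸ U, σ q.out x))
    {θ : ℝ≥0} (hθ : θ < 1)
    {c : G → V.toAffine.Point} (hc : ∀ g h, c (g * h) = c g + T g (c h))
    (hcK : ∀ g, c g ∈ kernel w V) (hcR : ∀ g, c g ∈ Rat) (hcU : ∀ u ∈ U, c u = 0)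
    (hcz : ∀ g, w (c g).zCoord ≤ w (∑ q : G ⧸ U, σ q.out x) ^ 2 * θ) :
    ∃ P : V.toAffine.Point, P ∈ kernel w V ∧ P ∈ Rat ∧ ∀ g, c g = T g P - P := by
  -- notation
  set y : L := ∑ q : G ⧸ U, σ q.out x with hydef
  set η : ℝ≥0 := w y with hηdef
  have hη1 : η ≤ 1 := by
    refine Valuation.map_sum_le w fun q _ ↦ ?_
    rw [hσw]; exact hx1
  -- the twisted crossed homomorphisms `c + ∂P'`
  have hcob : ∀ P' : V.toAffine.Point, ∀ g h,
      c (g * h) + (T (g * h) P' - P') = (c g + (T g P' - P')) + T g (c h + (T h P' - P')) :=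
    fun P' g h ↦ cocycle_add_coboundary hc hT P' g h
  have hcobK : ∀ P' ∈ kernel w V, ∀ g, c g + (T g P' - P') ∈ kernel w V := fun P' hP' g ↦
    (kernel w V).add_mem (hcK g) ((kernel w V).sub_mem (hTker g P' hP') hP')
  have hcobR : ∀ P' ∈ Rat, ∀ g, c g + (T g P' - P') ∈ Rat := fun P' hP' g ↦
    Rat.add_mem (hcR g) (Rat.sub_mem (hRatT g P' hP') hP')
  -- the invariant at level `r`
  let Inv : ℕ → V.toAffine.Point → Prop := fun r P' ↦
    P' ∈ kernel w V ∧ P' ∈ Rat ∧ (∀ u ∈ U, c u + (T u P' - P') = 0) ∧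
      ∀ g, w (c g + (T g P' - P')).zCoord ≤ η ^ 2 * θ ^ (r + 1)
  have hInv0 : Inv 0 0 := by
    refine ⟨(kernel w V).zero_mem, Rat.zero_mem, fun u hu ↦ ?_, fun g ↦ ?_⟩
    · rw [hcU u hu, map_zero, sub_zero, add_zero]
    · rw [map_zero, sub_zero, add_zero, zero_add, pow_one]; exact hcz g
  -- the step
  have hstep : ∀ (r : ℕ) (P' : {P' // Inv r P'}), ∃ P'' : {P'' // Inv (r + 1) P''},
      w (P''.1.zCoord - P'.1.zCoord) ≤ θ ^ (r + 1) := by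
    rintro r ⟨P', hP'K, hP'R, hP'U, hP'z⟩
    have hs : θ ^ (r + 1) < 1 := pow_lt_one₀ zero_le hθ (Nat.succ_ne_zero r)
    obtain ⟨Q, hQK, hQR, hQz, hQU, hQest⟩ := exists_step_of_trace hσmul hσw hTker hTz hSσ hσU hRatU
      hRatz hlift hx1 hxS hy hs (hcob P') (hcobK P' hP'K) (hcobR P' hP'R) hP'U hP'z
    have e1 : ∀ g, c g + (T g (P' + Q) - (P' + Q)) = (c g + (T g P' - P')) + (T g Q - Q) := by
      intro g; rw [map_add]; abel
    refine ⟨⟨P' + Q, (kernel w V).add_mem hP'K hQK, Rat.add_mem hP'R hQR, fun u hu ↦ ?_,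
      fun g ↦ ?_⟩, ?_⟩
    · rw [e1, hQU u hu]
    · rw [e1]
      refine (hQest g).trans ?_
      rw [← pow_mul]
      exact mul_le_mul_of_nonneg_left (pow_le_pow_right_of_le_one' hθ.le (by omega)) zero_le
    · change w ((P' + Q).zCoord - P'.zCoord) ≤ θ ^ (r + 1)
      rw [val_zCoord_add_sub_eq hP'K hQK]
      refine hQz.trans ?_
      calc η * θ ^ (r + 1) ≤ 1 * θ ^ (r + 1) := by gcongr
        _ = θ ^ (r + 1) := one_mul _
  choose next hnext using hstep
  -- the sequence of partial sums and its parameters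
  let seq : ∀ r : ℕ, {P' // Inv r P'} := fun r ↦ Nat.rec ⟨0, hInv0⟩ (fun r s ↦ next r s) r
  have hseq_succ : ∀ r, seq (r + 1) = next r (seq r) := fun r ↦ rfl
  set a : ℕ → L := fun r ↦ (seq r).1.zCoord with hadef
  have haS : ∀ r, a r ∈ S := fun r ↦ hRatz _ (seq r).2.2.1 (seq r).2.1
  have hcauchy : ∀ r, w (a (r + 1) - a r) ≤ θ ^ (r + 1) := by
    intro r
    simp only [hadef]
    rw [hseq_succ]
    exact hnext r (seq r)
  obtain ⟨z, hzS, hz⟩ := hcomplete θ hθ a haS hcauchy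
  have ha0 : a 0 = 0 := by
    simp only [hadef]
    exact WeierstrassCurve.Affine.Point.zCoord_zero
  have hzw : w z < 1 := by
    have h := hz 0
    rw [ha0, sub_zero, zero_add, pow_one] at h
    exact h.trans_lt hθ
  obtain ⟨P, hPK, hPR, hPz⟩ := hlift z hzS hzw
  refine ⟨-P, (kernel w V).neg_mem hPK, Rat.neg_mem hPR, fun g ↦ ?_⟩
  -- `c g + (T g P - P)` has arbitrarily small parameter
  have hTPK : T g P ∈ kernel w V := hTker g P hPK
  have hRK : c g + (T g P - P) ∈ kernel w V := hcobK P hPK g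
  have hRsmall : ∀ r, w (c g + (T g P - P)).zCoord ≤ θ ^ (r + 1) := by
    intro r
    obtain ⟨hP'K, -, -, hP'z⟩ := (seq r).2
    have hDK : P - (seq r).1 ∈ kernel w V := (kernel w V).sub_mem hPK hP'K
    have hTDK : T g (P - (seq r).1) ∈ kernel w V := hTker g _ hDK
    have hDz : w (P - (seq r).1).zCoord ≤ θ ^ (r + 1) := by
      rw [← val_zCoord_sub hPK hP'K, hPz]
      exact hz r
    have hTD : w (T g (P - (seq r).1) - (P - (seq r).1)).zCoord ≤ θ ^ (r + 1) := by
      refine (val_zCoord_sub_le hTDK hDK).trans (max_le ?_ hDz)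
      rw [hTz g _ hDK, hσw]
      exact hDz
    have eR : c g + (T g P - P) =
        (c g + (T g (seq r).1 - (seq r).1)) + (T g (P - (seq r).1) - (P - (seq r).1)) := by
      rw [map_sub]; abel
    rw [eR]
    refine (val_zCoord_add_le (hcobK _ hP'K g) ((kernel w V).sub_mem hTDK hDK)).trans
      (max_le ((hP'z g).trans ?_) hTD)
    calc η ^ 2 * θ ^ (r + 1) ≤ 1 * θ ^ (r + 1) := by gcongr; exact pow_le_one₀ zero_le hη1
      _ = θ ^ (r + 1) := one_mul _
  have hRz : (c g + (T g P - P)).zCoord = 0 := by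
    by_contra h0
    have hpos : 0 < w (c g + (T g P - P)).zCoord := (Valuation.pos_iff w).mpr h0
    obtain ⟨r, hr⟩ := exists_pow_lt_of_lt_one hpos hθ
    have h1 : θ ^ (r + 1) ≤ θ ^ r := pow_le_pow_right_of_le_one' hθ.le (Nat.le_succ r)
    exact lt_irrefl _ (((hRsmall r).trans h1).trans_lt hr)
  have hR0 := (zCoord_eq_zero_iff hRK).mp hRz
  rw [map_neg, sub_neg_eq_add]
  rw [← sub_eq_zero]
  rw [← hR0]
  abel

end Step

end Summit.BirchSwinnertonDyer.Rank1Residual.Additive.GoodModelLine.AlmostEtale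

end
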